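import Mathlib
import Summits.Ventures.HodgeRepro.Tier4.Target
import Summits.Ventures.HodgeRepro.Tier4.Common.TargetData
import Summits.Ventures.HodgeRepro.Tier4.Common.AutForms
import Summits.Ventures.HodgeRepro.Tier4.Common.FundamentalDomain
import Summits.Ventures.HodgeRepro.Tier4.Common.ProperDiscontinuity
import Summits.Ventures.HodgeRepro.Tier4.LitCompactness

/-!
# Tier4/Common/CocompactDomain — from cocompactness (K) to a RELATIVELY COMPACT fundamental domain

Blind re-derivation cell `pub-hodge-repro`, Tier 4 «prove the step» (README §9–§10), seat t4-L4-p1 (prover, LINE L4,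
gen 0).  Tree path `lean/Summits/Ventures/HodgeRepro/Tier4/Common/CocompactDomain.lean`.

WHAT IS PROVED.  The lexicographic transversal `dom d Γ'` of `Tier4/Common/FundamentalDomain.lean` is a fundamental
domain (`isFundamentalDomainFor_dom`), and it is contained in `{nsq ≤ r}` as soon as SOME set `K₀ ⊆ {nsq ≤ r}` meets every
orbit (`nsq_dom_le`: the `key`-least point of an orbit is in particular `nsq`-least).  Hence from the single displayed
cocompactness input `Lit.BorelHarishChandra1962_Thm11_8_cocompact_hdef` (Godement; `Tier4/LitCompactness.lean`) every level
has a fundamental domain inside a closed ball of radius `< 1` — the shape L3 displays (`exists_domain_nsq_le`, the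
conclusion of lit-3's `…_fundamentalDomain_hdef` Prop for the datum) and the shape typer-1's `finiteDimensional_holoForms`
consumes, `closure D ⊆ 𝔹²` (`exists_domain_closure_subset`).  No literature input beyond the displayed (K).

HC_CM is NOT proved by anyone in this repository.
-/

set_option autoImplicit false

noncomputable section

open Matrix Metric NumberField MeasureTheory
open scoped ComplexConjugate ComplexOrder

namespace Summit.Ventures.HodgeRepro.Tier4

variable {F E : Type} [Field F] [NumberField F] [IsGalois ℚ F] [IsCMField F]
  [Field E] [NumberField E] [IsGalois ℚ E] [IsCMField E] (d : TargetData F E)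

/-- **The transversal is a fundamental domain** (the explicit form of `exists_fundamentalDomain`). -/
theorem isFundamentalDomainFor_dom {Γ' : Set (Matrix (Fin 3) (Fin 3) E)} (hΓ' : d.IsLevel Γ') :
    IsFundamentalDomainFor (ballActions d.τ₀ d.C Γ') (dom d Γ') := by
  refine ⟨measurableSet_dom d hΓ'.2, dom_subset_ball d Γ', ?_, ?_⟩
  · refine ae_restrict_of_forall_mem isOpen_ball.measurableSet fun z hz => ?_
    obtain ⟨γ, hγ, hmem⟩ := exists_act_mem_dom d hΓ' hz
    exact ⟨actM (toBallMat d.τ₀ d.C γ), ⟨γ, hγ, rfl⟩, hmem⟩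
  · rintro φ ⟨γ₁, h₁, rfl⟩ ψ ⟨γ₂, h₂, rfl⟩ hne
    exact volume_image_inter_image d hΓ' h₁ h₂ hne

/-- The transversal is `d.IsDomain`. -/
theorem isDomain_dom {Γ' : Set (Matrix (Fin 3) (Fin 3) E)} (hΓ' : d.IsLevel Γ') : d.IsDomain Γ' (dom d Γ') :=
  isFundamentalDomainFor_dom d hΓ'

/-- If a set `K₀ ⊆ {nsq ≤ r}` meets every `Γ′`-orbit of the ball, the transversal lies in `{nsq ≤ r}`. -/
theorem nsq_dom_le {Γ' : Set (Matrix (Fin 3) (Fin 3) E)} {K₀ : Set (Fin 2 → ℂ)}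
    (hK₀ : ∀ z ∈ ball, ∃ γ ∈ Γ', d.act γ z ∈ K₀) {r : ℝ} (hK₀r : ∀ z ∈ K₀, nsq z ≤ r)
    {w : Fin 2 → ℂ} (hw : w ∈ dom d Γ') : nsq w ≤ r := by
  obtain ⟨γ, hγ, hγK⟩ := hK₀ w hw.1
  exact (nsq_le_of_key_le (hw.2 γ hγ)).trans (hK₀r _ hγK)

/-- **From cocompactness (K): a fundamental domain inside a closed ball of radius `< 1`** — the shape L3 displays
(lit-3's `BorelHarishChandra1962_Thm11_8_fundamentalDomain_hdef`, for the datum). -/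
theorem exists_domain_nsq_le (hK : Lit.BorelHarishChandra1962_Thm11_8_cocompact_hdef E d.H d.τ₀ d.C)
    {Γ' : Set (Matrix (Fin 3) (Fin 3) E)} (hΓ' : d.IsLevel Γ') :
    ∃ D : Set (Fin 2 → ℂ), d.IsDomain Γ' D ∧ ∃ r : ℝ, r < 1 ∧ ∀ z ∈ D, nsq z ≤ r := by
  obtain ⟨K₀, hK₀c, hK₀b, hK₀orb⟩ := hK d.hH d.hani d.hC d.hdef Γ' hΓ'.1
  obtain ⟨t, ht0, ht1, hK₀t⟩ := exists_nsq_le_of_isCompact hK₀c hK₀b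
  refine ⟨dom d Γ', isDomain_dom d hΓ', t ^ 2, by nlinarith, fun z hz => ?_⟩
  exact nsq_dom_le d hK₀orb hK₀t hz

/-- **From cocompactness (K): a fundamental domain with closure inside the ball** (the `hDc` shape of typer-1's
`finiteDimensional_holoForms`). -/
theorem exists_domain_closure_subset (hK : Lit.BorelHarishChandra1962_Thm11_8_cocompact_hdef E d.H d.τ₀ d.C)
    {Γ' : Set (Matrix (Fin 3) (Fin 3) E)} (hΓ' : d.IsLevel Γ') :
    ∃ D : Set (Fin 2 → ℂ), d.IsDomain Γ' D ∧ closure D ⊆ ball := by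
  obtain ⟨D, hD, r, hr, hDr⟩ := exists_domain_nsq_le d hK hΓ'
  refine ⟨D, hD, ?_⟩
  have hcl : closure D ⊆ {z : Fin 2 → ℂ | nsq z ≤ r} :=
    closure_minimal (fun z hz => hDr z hz) (isClosed_le continuous_nsq continuous_const)
  intro z hz
  show nsq z < 1
  exact lt_of_le_of_lt (hcl hz) hr

end Summit.Ventures.HodgeRepro.Tier4

end

#print axioms Summit.Ventures.HodgeRepro.Tier4.isFundamentalDomainFor_dom
#print axioms Summit.Ventures.HodgeRepro.Tier4.exists_domain_closure_subset
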